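import Literature.Computability.AlgebraicComplexity.BLMW11PerOrbitCeiling
import Literature.Computability.AlgebraicComplexity.OrbitClosureInheritance
import Mathlib.LinearAlgebra.Trace
import Mathlib.GroupTheory.Perm.Finite
import HarnessLib

/-!
# BLMW 2011, Prop. 5.6.2 (proof, part 1): the stabilizing family of the padded permanent
# `x₀₀^{n-m} per_m` in `W^{⊗D}`, its fixed space, and the character of that space

P. Bürgisser, J. M. Landsberg, L. Manivel, J. Weyman, SIAM J. Comput. 40 (2011) = arXiv:0907.2850,
§5.6 "Second Main Example": `W = A ⊕ A' ⊕ B`, `A = E ⊗ F ≃ Mat_{m×m}`, `dim A' = 1`, `dim W = n²`,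
`x = ℓ^{n-m} per_m` (`ℓ ∈ A'`); (5.6.1) the stabilizer `GL(W)(x) ⊇ {(ξ g, η, *) : g ∈ GL(W)(per_m),
η^{n-m} ξ^m = 1}`; Def. 5.6.1 / Prop. 5.6.2 (5.6.2): `ℂ[\overline{GL(W)·x}]_δ ⊆
⊕_π (S_πW^*)^{mult^n_π}` with `mult^n_π = ∑_{π ↦ π'} mult_{π'}` — "Proposition 5.5.2 and Example 5.4
show" it, i.e. Pieri's formula `S_π(A ⊕ A') = ⊕_{π ↦ π'} S_{π'}A ⊗ S^{|π|-|π'|}A'` (Prop. 4.5.4)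
applied to the `GL(W)(x)`-invariants. This file is the word-model half of that argument (cell
`val-lit`, row BLMW11-A, discharge of the named fact `BLMW2011_prop_5_6_2_closure`; the assembly
with Pieri's rule for `𝔖_n`-characters and `perOrbitCeiling_eq_multPer` is the sibling
`BLMW11PaddedPerOrbitCeilingProofs.lean`). In the tree's coordinates (`paddedPerFormLex k m n`: the
`m × m` block is the BOTTOM-RIGHT block of the `n × n` matrix letters, the padding letter is `x₀₀`):

* §1 `PadPer.blockLetter`, `PadPer.padLetter`: the letters of `A` (as an embedding
  `Fin (m·m) → Fin (n·n)` of the alphabets of the word models, through `matIdxEquiv`) and `ℓ = x₀₀`.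
* §2 **the stabilizing family** `PadPer.IsPadPerStab` of `x₀₀^{n-m} per_m` in `GL_{n²}`: the
  per-family `IsPerStab` of `BLMW11PerOrbitCeiling.lean` (torus pairs, `𝔚_E × 𝔚_F`, transposition)
  extended block-diagonally to `W` (`extendGL`), the BALANCE torus element
  (`2^{n-m}` on `A`, `2^{-m}` on `ℓ`, `1` on `B`: `η^{n-m} ξ^m = 1` in (5.6.1)) and the KILL torus
  element (`2` on `B`, `1` on `A ⊕ A'`; the `*`-block of (5.6.1) contains `GL(B)`); its common fixed
  space `PadPer.padInvariants k hmn D ⊆ W^{⊗D}` (functions on words `[D] → [n²]`).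
* §3–§4 restriction/extension along a splitting `e : [a] ⊔ [b] ≃ [D]` of the positions
  (`PadPer.restrictMap`, `PadPer.extendMap`): a word `u : [a] → A` is padded by `ℓ` on the `b`
  positions `e(inr ·)`; these maps intertwine the extended family with the per-family
  (`restrictMap_wordRep_extendGL`, `wordRep_extendGL_extendMap`) and the position permutations
  `e (σ ⊔ ρ) e⁻¹` with `σ` (`restrictMap_wordPerm_permCongr`).
* §5 **structure**: a fixed function is supported on the words with no `B`-letter and exactly `b`
  letters `ℓ` where `(n-m)·a = m·b`, `a + b = D` (`apply_eq_zero_of_mem_padInvariants`), and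
  `padInvariants = ⊕_{S ⊂ [D], |S| = b} E_S(X_per(a))`, `X_per(a) = perStabInvariants k m a`
  (`sum_extendMap_restrictMap`): BLMW's `(S_π W)^{GL(W)(x)} ⊆ ⊕_{π ↦ π'} (S_{π'}A)^{GL(A)(per_m)}`
  at the level of `W^{⊗D}`.
* §6 **the character**: for every `f : 𝔖_D → k`,
  `∑_τ f(τ) χ_{padInvariants}(τ) = ∑_{|S| = b} ∑_{σ ∈ 𝔖_a} ∑_{ρ ∈ 𝔖_b} f(e_S (σ ⊔ ρ) e_S⁻¹) χ_{X_per(a)}(σ)`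
  (`sum_mul_character_padInvariants`): the trace of `τ ∘ E_S ∘ R_S` is `χ_{X_per}(σ)` if `τ` fixes
  `S` (as `e_S(σ ⊔ ρ)e_S⁻¹`) and `0` otherwise — the character of the induced module
  `Ind_{𝔖_a × 𝔖_b}^{𝔖_D} (X_per(a) ⊠ 1)`.

Honest framing: classical invariant theory / Schur–Weyl bookkeeping for a printed GCT example;
VP ≠ VNP is NOT proved and nothing here bears on it. The `def`s are plumbing with bodies (letters,
family, fixed space, padding maps, splittings); no named facts (D-0026).

## References

* [BurgisserEtAl2011] §5.6 (5.6.1), Def. 5.6.1, Prop. 5.6.2 (5.6.2); §5.5 (5.5.1), Prop. 5.5.2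
  (proof); Prop. 4.5.4 (Pieri); §4.1 (4.1.2). arXiv v2 pp. 11–12.
* [FultonHarrisGTM129] §6.1 Lemma 6.22 (the commuting actions on `V^{⊗d}`), §2.1 (characters,
  `χ_{V} = ∑` of diagonal blocks), §3.3 (induced representations, Ex. 3.19 character formula).

## Tree

`IsPerStab`, `perStabInvariants`, `perStabInvariants_le_comap`, `mem_perStabInvariants_iff`
(`BLMW11PerOrbitCeiling`); `extendGL`, `extendMatrix_*`, `topEmb` (`OrbitClosureInheritance`);
`wordRep`, `wordRep_apply`, `wordPerm`, `wordPermRep_apply`, `wordPerm_wordRep`,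
`wordRep_diagonal_apply` (`TensorWordModel`); `matIdxEquiv` (`SchurWeylPlethysm`).
-/

noncomputable section

open scoped BigOperators
open Finset

namespace Literature.Computability.AlgebraicComplexity

open _root_.Literature.NumberTheory.DiophantineGeometry

namespace PadPer

/-! ### §1 Letters: the block `A = Mat_{m×m}` inside `Mat_{n×n}` and the padding letter `ℓ = x₀₀` -/

section Letters

variable {m n : ℕ}

/-- The letters of the `m × m` block `A` inside the `n²` matrix letters, in the `Fin`-enumerations of
the word models (`matIdxEquiv`): `(i, j) ↦ (n - m + i, n - m + j)`, the bottom-right block of the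
tree's `paddedPerPoly`. BLMW 2011 §5.6: `W = A ⊕ A' ⊕ B`. [cite: BurgisserEtAl2011, §5.6] -/
def blockLetter (hmn : m ≤ n) (x : Fin (m * m)) : Fin (n * n) :=
  (matIdxEquiv n).symm
    (toLex (topEmb hmn (ofLex (matIdxEquiv m x)).1, topEmb hmn (ofLex (matIdxEquiv m x)).2))

/-- Unfolding of `blockLetter` through `matIdxEquiv n`. [cite: BurgisserEtAl2011, Prop. 5.6.2 (proof)] -/
theorem matIdxEquiv_blockLetter (hmn : m ≤ n) (x : Fin (m * m)) :
    matIdxEquiv n (blockLetter hmn x) =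
      toLex (topEmb hmn (ofLex (matIdxEquiv m x)).1, topEmb hmn (ofLex (matIdxEquiv m x)).2) := by
  rw [blockLetter, OrderIso.apply_symm_apply]

/-- The block-letter map is injective. [cite: BurgisserEtAl2011, Prop. 5.6.2 (proof)] -/
theorem blockLetter_injective (hmn : m ≤ n) : Function.Injective (blockLetter hmn) := by
  intro x y hxy
  have h := congrArg (matIdxEquiv n) hxy
  rw [matIdxEquiv_blockLetter, matIdxEquiv_blockLetter] at h
  have h' := toLex.injective h
  rw [Prod.mk.injEq] at h'
  have h1 := (topEmb_strictMono hmn).injective h'.1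
  have h2 := (topEmb_strictMono hmn).injective h'.2
  apply (matIdxEquiv m).injective
  rw [← toLex_ofLex (matIdxEquiv m x), ← toLex_ofLex (matIdxEquiv m y)]
  exact congrArg toLex (Prod.ext h1 h2)

/-- The padding letter `ℓ = x₀₀` (top-left entry, outside the bottom-right block when `m < n`).
BLMW 2011 §5.6: `ℓ ∈ A'`. [cite: BurgisserEtAl2011, §5.6] -/
def padLetter (n : ℕ) [NeZero n] : Fin (n * n) :=
  (matIdxEquiv n).symm (toLex ((0 : Fin n), (0 : Fin n)))

/-- For `m < n` the padding letter is not a block letter. [cite: BurgisserEtAl2011, Prop. 5.6.2 (proof)] -/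
theorem padLetter_ne_blockLetter [NeZero n] (hmn : m < n) (x : Fin (m * m)) :
    padLetter n ≠ blockLetter hmn.le x := by
  intro h
  have h' := congrArg (matIdxEquiv n) h
  rw [padLetter, OrderIso.apply_symm_apply, matIdxEquiv_blockLetter] at h'
  have h'' := congrArg (fun z => ((ofLex z).1 : ℕ)) h'
  simp only [ofLex_toLex, topEmb_val, Fin.val_zero] at h''
  omega

/-- For `m < n` the padding letter is off the range of the block letters. [cite: BurgisserEtAl2011, Prop. 5.6.2 (proof)] -/
theorem padLetter_not_mem_range [NeZero n] (hmn : m < n) :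
    padLetter n ∉ Set.range (blockLetter hmn.le) := by
  rintro ⟨x, hx⟩
  exact padLetter_ne_blockLetter hmn x hx.symm

end Letters

/-! ### §2 The stabilizing family of `x₀₀^{n-m} per_m` and its fixed space in `W^{⊗D}` -/

section Family

variable (k : Type*) [Field k] {m n : ℕ}

open Classical in
/-- The BALANCE diagonal: `2^{n-m}` on the block letters, `2^{-m}` on the padding letter, `1` on the
rest (`(ξ, η) = (2^{n-m}, 2^{-m})` has `η^{n-m} ξ^m = 1`, BLMW (5.6.1)). [cite: BurgisserEtAl2011, §5.6 (5.6.1)] -/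
def balanceDiag [NeZero n] (hmn : m ≤ n) : Fin (n * n) → k := fun x =>
  if x ∈ Set.range (blockLetter hmn) then (2 : k) ^ (n - m)
  else if x = padLetter n then ((2 : k) ^ m)⁻¹ else 1

open Classical in
/-- The KILL diagonal: `2` on the letters of `B` (neither block nor padding), `1` elsewhere
(an element of the `GL(B)`-part `*` of BLMW (5.6.1)). [cite: BurgisserEtAl2011, §5.6 (5.6.1)] -/
def killDiag [NeZero n] (hmn : m ≤ n) : Fin (n * n) → k := fun x =>
  if x ∈ Set.range (blockLetter hmn) ∨ x = padLetter n then 1 else 2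

variable [CharZero k]

/-- The balance diagonal is invertible. [cite: BurgisserEtAl2011, Prop. 5.6.2 (proof)] -/
theorem det_diagonal_balanceDiag_ne_zero [NeZero n] (hmn : m ≤ n) :
    (Matrix.diagonal (balanceDiag k hmn)).det ≠ 0 := by
  rw [Matrix.det_diagonal]
  refine Finset.prod_ne_zero_iff.mpr fun x _ => ?_
  unfold balanceDiag
  split_ifs
  · exact pow_ne_zero _ two_ne_zero
  · exact inv_ne_zero (pow_ne_zero _ two_ne_zero)
  · exact one_ne_zero

/-- The kill diagonal is invertible. [cite: BurgisserEtAl2011, Prop. 5.6.2 (proof)] -/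
theorem det_diagonal_killDiag_ne_zero [NeZero n] (hmn : m ≤ n) :
    (Matrix.diagonal (killDiag k hmn)).det ≠ 0 := by
  rw [Matrix.det_diagonal]
  refine Finset.prod_ne_zero_iff.mpr fun x _ => ?_
  unfold killDiag
  split_ifs
  · exact one_ne_zero
  · exact two_ne_zero

/-- The balance element of `GL_{n²}`. [cite: BurgisserEtAl2011, §5.6 (5.6.1)] -/
def balanceGL [NeZero n] (hmn : m ≤ n) : GL (Fin (n * n)) k :=
  Matrix.GeneralLinearGroup.mkOfDetNeZero _ (det_diagonal_balanceDiag_ne_zero k hmn)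

/-- The kill element of `GL_{n²}`. [cite: BurgisserEtAl2011, §5.6 (5.6.1)] -/
def killGL [NeZero n] (hmn : m ≤ n) : GL (Fin (n * n)) k :=
  Matrix.GeneralLinearGroup.mkOfDetNeZero _ (det_diagonal_killDiag_ne_zero k hmn)

/-- **The stabilizing family of the padded permanent `x₀₀^{n-m} per_m` in `GL(W)`, `dim W = n²`**:
the per-family `IsPerStab` (torus pairs, row/column relabellings, transposition of the `m × m`
block) extended block-diagonally by the identity (`extendGL` along `blockLetter`), the balance
element and the kill element — all inside the stabilizer (5.6.1)
`{(ξ g, η, *) : g ∈ GL(A)(per_m), η^{n-m}ξ^m = 1}` (proved in the sibling file).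
[cite: BurgisserEtAl2011, §5.6 (5.6.1)] -/
def IsPadPerStab [NeZero n] (hmn : m < n) (g : GL (Fin (n * n)) k) : Prop :=
  (∃ h, IsPerStab k m h ∧ g = extendGL k (blockLetter_injective hmn.le) h) ∨
    g = balanceGL k hmn.le ∨ g = killGL k hmn.le

/-- **The fixed space of the family in `W^{⊗D}`** (functions on words `[D] → [n²]` fixed by every
element of `IsPadPerStab`); it contains the `GL(W)(x)`-invariants of BLMW's
`dim (S_πW)^{GL(W)(x)} = mult^n_π` computation (Prop. 5.6.2 via (4.1.2)).
[cite: BurgisserEtAl2011, Prop. 5.6.2] -/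
def padInvariants [NeZero n] (hmn : m < n) (D : ℕ) : Submodule k (Word (n * n) D → k) where
  carrier := {y | ∀ g, IsPadPerStab k hmn g → wordRep k (n * n) D g y = y}
  add_mem' {x y} hx hy g hg := by rw [map_add, hx g hg, hy g hg]
  zero_mem' g _ := by rw [map_zero]
  smul_mem' c {x} hx g hg := by rw [map_smul, hx g hg]

variable {k}

/-- Membership in `padInvariants` (unfolding lemma). [cite: BurgisserEtAl2011, Prop. 5.6.2] -/
theorem mem_padInvariants_iff [NeZero n] {hmn : m < n} {D : ℕ} (y : Word (n * n) D → k) :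
    y ∈ padInvariants k hmn D ↔ ∀ g, IsPadPerStab k hmn g → wordRep k (n * n) D g y = y :=
  Iff.rfl

variable (k) in
/-- `𝔖_D`-stability of `padInvariants` (the actions of `𝔖_D` and `GL_{n²}` on `W^{⊗D}` commute,
Fulton–Harris Lemma 6.22). [cite: FultonHarrisGTM129, §6.1 Lemma 6.22] -/
theorem padInvariants_le_comap [NeZero n] (hmn : m < n) {D : ℕ} (τ : Equiv.Perm (Fin D)) :
    padInvariants k hmn D ≤ (padInvariants k hmn D).comap (wordPermRep k (n * n) D τ) := by
  intro y hy g hg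
  change wordRep k (n * n) D g (wordPerm k τ y) = wordPerm k τ y
  rw [← wordPerm_wordRep, hy g hg]

/-- The balance element acts on a word function by the weight
`(2^{n-m})^{#block letters} · (2^{-m})^{#padding letters}`… in the form
`(∏_p balanceDiag (w p)) · y(w)`. [cite: BurgisserEtAl2011, Prop. 5.6.2 (proof)] -/
theorem wordRep_balanceGL_apply [NeZero n] (hmn : m ≤ n) {D : ℕ} (y : Word (n * n) D → k)
    (w : Word (n * n) D) :
    wordRep k (n * n) D (balanceGL k hmn) y w = (∏ p, balanceDiag k hmn (w p)) * y w :=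
  wordRep_diagonal_apply k _ _ y w

/-- The kill element acts on a word function by `2^{#letters of B} · y(w)`. [cite: BurgisserEtAl2011, Prop. 5.6.2 (proof)] -/
theorem wordRep_killGL_apply [NeZero n] (hmn : m ≤ n) {D : ℕ} (y : Word (n * n) D → k)
    (w : Word (n * n) D) :
    wordRep k (n * n) D (killGL k hmn) y w = (∏ p, killDiag k hmn (w p)) * y w :=
  wordRep_diagonal_apply k _ _ y w

end Family

/-! ### §3 Padding words along a splitting of the positions -/

section Words

variable (k : Type*) [Field k] {m n a b D : ℕ} [NeZero n]

/-- The padded word of `u : [a] → A` along the splitting `e : [a] ⊔ [b] ≃ [D]`: the block letter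
`u i` at position `e (inl i)`, the padding letter `ℓ` at the positions `e (inr j)`. [cite: BurgisserEtAl2011, Prop. 5.6.2 (proof)] -/
def padWord (hmn : m ≤ n) (e : Fin a ⊕ Fin b ≃ Fin D) (u : Word (m * m) a) : Word (n * n) D :=
  fun p => Sum.elim (fun i => blockLetter hmn (u i)) (fun _ => padLetter n) (e.symm p)

/-- A word is a padded word along `e`: block letters at `e (inl ·)`, padding at `e (inr ·)`.
[cite: BurgisserEtAl2011, Prop. 5.6.2 (proof)] -/
def IsPadWord (hmn : m ≤ n) (e : Fin a ⊕ Fin b ≃ Fin D) (w : Word (n * n) D) : Prop :=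
  (∀ i, w (e (Sum.inl i)) ∈ Set.range (blockLetter hmn)) ∧ ∀ j, w (e (Sum.inr j)) = padLetter n

/-- Reading off the block word of a padded word. [cite: BurgisserEtAl2011, Prop. 5.6.2 (proof)] -/
def readWord (hmn : m ≤ n) (e : Fin a ⊕ Fin b ≃ Fin D) (w : Word (n * n) D)
    (hw : IsPadWord hmn e w) : Word (m * m) a :=
  fun i => (Equiv.ofInjective _ (blockLetter_injective hmn)).symm ⟨w (e (Sum.inl i)), hw.1 i⟩

variable {k}

/-- The padded word at a block position. [cite: BurgisserEtAl2011, Prop. 5.6.2 (proof)] -/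
@[simp]
theorem padWord_apply_inl (hmn : m ≤ n) (e : Fin a ⊕ Fin b ≃ Fin D) (u : Word (m * m) a) (i : Fin a) :
    padWord hmn e u (e (Sum.inl i)) = blockLetter hmn (u i) := by
  simp [padWord]

/-- The padded word at a padding position. [cite: BurgisserEtAl2011, Prop. 5.6.2 (proof)] -/
@[simp]
theorem padWord_apply_inr (hmn : m ≤ n) (e : Fin a ⊕ Fin b ≃ Fin D) (u : Word (m * m) a) (j : Fin b) :
    padWord hmn e u (e (Sum.inr j)) = padLetter n := by
  simp [padWord]

/-- A padded word is a pad word. [cite: BurgisserEtAl2011, Prop. 5.6.2 (proof)] -/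
theorem isPadWord_padWord (hmn : m ≤ n) (e : Fin a ⊕ Fin b ≃ Fin D) (u : Word (m * m) a) :
    IsPadWord hmn e (padWord hmn e u) :=
  ⟨fun i => ⟨u i, (padWord_apply_inl hmn e u i).symm⟩, fun j => padWord_apply_inr hmn e u j⟩

/-- `blockLetter (readWord w i) = w (e (inl i))`. [cite: BurgisserEtAl2011, Prop. 5.6.2 (proof)] -/
theorem blockLetter_readWord (hmn : m ≤ n) (e : Fin a ⊕ Fin b ≃ Fin D) (w : Word (n * n) D)
    (hw : IsPadWord hmn e w) (i : Fin a) : blockLetter hmn (readWord hmn e w hw i) = w (e (Sum.inl i)) := by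
  unfold readWord
  exact Equiv.apply_ofInjective_symm (blockLetter_injective hmn) _

/-- Reading off the padded word of `u` returns `u`. [cite: BurgisserEtAl2011, Prop. 5.6.2 (proof)] -/
theorem readWord_padWord (hmn : m ≤ n) (e : Fin a ⊕ Fin b ≃ Fin D) (u : Word (m * m) a)
    (hw : IsPadWord hmn e (padWord hmn e u)) : readWord hmn e (padWord hmn e u) hw = u := by
  funext i
  apply blockLetter_injective hmn
  rw [blockLetter_readWord, padWord_apply_inl]

/-- Padding the block word read off a pad word returns the word. [cite: BurgisserEtAl2011, Prop. 5.6.2 (proof)] -/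
theorem padWord_readWord (hmn : m ≤ n) (e : Fin a ⊕ Fin b ≃ Fin D) (w : Word (n * n) D)
    (hw : IsPadWord hmn e w) : padWord hmn e (readWord hmn e w hw) = w := by
  funext p
  obtain ⟨q, rfl⟩ := e.surjective p
  rcases q with i | j
  · rw [padWord_apply_inl, blockLetter_readWord]
  · rw [padWord_apply_inr, hw.2 j]

/-- `padWord` is injective. [cite: BurgisserEtAl2011, Prop. 5.6.2 (proof)] -/
theorem padWord_injective (hmn : m ≤ n) (e : Fin a ⊕ Fin b ≃ Fin D) :
    Function.Injective (padWord hmn e) := by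
  intro u v h
  funext i
  apply blockLetter_injective hmn
  rw [← padWord_apply_inl hmn e u i, ← padWord_apply_inl hmn e v i, h]

variable (k)

/-- **Restriction along a splitting**: `(R_e y)(u) = y(padWord e u)`. [cite: BurgisserEtAl2011, Prop. 5.6.2 (proof)] -/
def restrictMap (hmn : m ≤ n) (e : Fin a ⊕ Fin b ≃ Fin D) :
    (Word (n * n) D → k) →ₗ[k] (Word (m * m) a → k) where
  toFun y u := y (padWord hmn e u)
  map_add' _ _ := rfl
  map_smul' _ _ := rfl

open Classical in
/-- **Extension along a splitting**: `(E_e x)(w) = x(readWord w)` on pad words, `0` elsewhere.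
[cite: BurgisserEtAl2011, Prop. 5.6.2 (proof)] -/
def extendMap (hmn : m ≤ n) (e : Fin a ⊕ Fin b ≃ Fin D) :
    (Word (m * m) a → k) →ₗ[k] (Word (n * n) D → k) where
  toFun x w := if hw : IsPadWord hmn e w then x (readWord hmn e w hw) else 0
  map_add' x y := by
    funext w
    simp only [Pi.add_apply]
    split_ifs <;> simp
  map_smul' c x := by
    funext w
    simp only [Pi.smul_apply, smul_eq_mul, RingHom.id_apply]
    split_ifs <;> simp

variable {k}

/-- Unfolding of `restrictMap`. [cite: BurgisserEtAl2011, Prop. 5.6.2 (proof)] -/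
@[simp]
theorem restrictMap_apply (hmn : m ≤ n) (e : Fin a ⊕ Fin b ≃ Fin D) (y : Word (n * n) D → k)
    (u : Word (m * m) a) : restrictMap k hmn e y u = y (padWord hmn e u) :=
  rfl

open Classical in
/-- Unfolding of `extendMap`. [cite: BurgisserEtAl2011, Prop. 5.6.2 (proof)] -/
theorem extendMap_apply (hmn : m ≤ n) (e : Fin a ⊕ Fin b ≃ Fin D) (x : Word (m * m) a → k)
    (w : Word (n * n) D) :
    extendMap k hmn e x w = if hw : IsPadWord hmn e w then x (readWord hmn e w hw) else 0 :=
  rfl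

/-- `E_e x` on a padded word. [cite: BurgisserEtAl2011, Prop. 5.6.2 (proof)] -/
theorem extendMap_apply_padWord (hmn : m ≤ n) (e : Fin a ⊕ Fin b ≃ Fin D) (x : Word (m * m) a → k)
    (u : Word (m * m) a) : extendMap k hmn e x (padWord hmn e u) = x u := by
  rw [extendMap_apply, dif_pos (isPadWord_padWord hmn e u), readWord_padWord]

/-- `E_e x` vanishes off the pad words. [cite: BurgisserEtAl2011, Prop. 5.6.2 (proof)] -/
theorem extendMap_apply_of_not (hmn : m ≤ n) (e : Fin a ⊕ Fin b ≃ Fin D) (x : Word (m * m) a → k)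
    {w : Word (n * n) D} (hw : ¬ IsPadWord hmn e w) : extendMap k hmn e x w = 0 := by
  rw [extendMap_apply, dif_neg hw]

/-- `R_e ∘ E_e = id`. [cite: BurgisserEtAl2011, Prop. 5.6.2 (proof)] -/
theorem restrictMap_extendMap (hmn : m ≤ n) (e : Fin a ⊕ Fin b ≃ Fin D) (x : Word (m * m) a → k) :
    restrictMap k hmn e (extendMap k hmn e x) = x := by
  funext u
  rw [restrictMap_apply, extendMap_apply_padWord]

open Classical in
/-- `E_e (R_e y)` is `y` restricted to the pad words of `e`. [cite: BurgisserEtAl2011, Prop. 5.6.2 (proof)] -/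
theorem extendMap_restrictMap_apply (hmn : m ≤ n) (e : Fin a ⊕ Fin b ≃ Fin D)
    (y : Word (n * n) D → k) (w : Word (n * n) D) :
    extendMap k hmn e (restrictMap k hmn e y) w = if IsPadWord hmn e w then y w else 0 := by
  classical
  by_cases hw : IsPadWord hmn e w
  · rw [if_pos hw, extendMap_apply, dif_pos hw, restrictMap_apply, padWord_readWord]
  · rw [if_neg hw, extendMap_apply_of_not hmn e _ hw]

end Words

/-! ### §4 Intertwining: the extended per-family, the tori, and the position permutations -/

section Intertwine

variable {k : Type*} [Field k] {m n a b D : ℕ} [NeZero n]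

/-- The block-diagonal extension of `h ∈ GL(A)` along `blockLetter` acts on a restricted function
as `h` does: `R_e ((ext h) · y) = h · (R_e y)`. [cite: BurgisserEtAl2011, Prop. 5.6.2 (proof)] -/
theorem restrictMap_wordRep_extendGL (hmn : m < n) (e : Fin a ⊕ Fin b ≃ Fin D)
    (h : GL (Fin (m * m)) k) (y : Word (n * n) D → k) :
    restrictMap k hmn.le e (wordRep k (n * n) D (extendGL k (blockLetter_injective hmn.le) h) y) =
      wordRep k (m * m) a h (restrictMap k hmn.le e y) := by
  funext u
  rw [restrictMap_apply, wordRep_apply, wordRep_apply]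
  -- the only words with a non-zero coefficient are the padded words
  rw [← Finset.sum_subset (Finset.subset_univ ((Finset.univ : Finset (Word (m * m) a)).image
      (padWord hmn.le e)))]
  · rw [Finset.sum_image (fun u₁ _ u₂ _ h => padWord_injective hmn.le e h)]
    refine Finset.sum_congr rfl fun u' _ => ?_
    rw [restrictMap_apply]
    congr 1
    rw [← e.prod_comp, Fintype.prod_sum_type]
    have h2 : ∏ j : Fin b, ((extendGL k (blockLetter_injective hmn.le) h : GL (Fin (n * n)) k) :
        Matrix (Fin (n * n)) (Fin (n * n)) k) (padWord hmn.le e u (e (Sum.inr j)))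
        (padWord hmn.le e u' (e (Sum.inr j))) = 1 := by
      refine Finset.prod_eq_one fun j _ => ?_
      rw [padWord_apply_inr, padWord_apply_inr, coe_extendGL,
        extendMatrix_of_not_mem _ _ (padLetter_not_mem_range hmn), if_pos rfl]
    rw [h2, mul_one]
    refine Finset.prod_congr rfl fun i _ => ?_
    rw [padWord_apply_inl, padWord_apply_inl, coe_extendGL, extendMatrix_app_app]
  · intro w _ hw
    have hnot : ¬ IsPadWord hmn.le e w := by
      intro hpw
      apply hw
      exact Finset.mem_image.mpr ⟨readWord hmn.le e w hpw, Finset.mem_univ _, padWord_readWord _ _ _ hpw⟩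
    -- some position carries a vanishing matrix coefficient
    unfold IsPadWord at hnot
    rw [not_and_or, not_forall, not_forall] at hnot
    rcases hnot with ⟨i, hi⟩ | ⟨j, hj⟩
    · rw [Finset.prod_eq_zero (Finset.mem_univ (e (Sum.inl i))), zero_mul]
      rw [padWord_apply_inl, coe_extendGL, extendMatrix_app_of_not_mem _ _ _ hi]
    · rw [Finset.prod_eq_zero (Finset.mem_univ (e (Sum.inr j))), zero_mul]
      rw [padWord_apply_inr, coe_extendGL, extendMatrix_of_not_mem _ _ (padLetter_not_mem_range hmn),
        if_neg (Ne.symm hj)]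

/-- The block-diagonal extension of `h ∈ GL(A)` acts on an extended function as `h` does:
`(ext h) · (E_e x) = E_e (h · x)`. [cite: BurgisserEtAl2011, Prop. 5.6.2 (proof)] -/
theorem wordRep_extendGL_extendMap (hmn : m < n) (e : Fin a ⊕ Fin b ≃ Fin D)
    (h : GL (Fin (m * m)) k) (x : Word (m * m) a → k) :
    wordRep k (n * n) D (extendGL k (blockLetter_injective hmn.le) h) (extendMap k hmn.le e x) =
      extendMap k hmn.le e (wordRep k (m * m) a h x) := by
  classical
  funext w
  rw [wordRep_apply]
  -- restrict the sum to the padded words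
  rw [← Finset.sum_subset (Finset.subset_univ ((Finset.univ : Finset (Word (m * m) a)).image
      (padWord hmn.le e)))]
  swap
  · intro w' _ hw'
    have hnot : ¬ IsPadWord hmn.le e w' := by
      intro hpw
      apply hw'
      exact Finset.mem_image.mpr ⟨readWord hmn.le e w' hpw, Finset.mem_univ _, padWord_readWord _ _ _ hpw⟩
    rw [extendMap_apply_of_not hmn.le e _ hnot, mul_zero]
  rw [Finset.sum_image (fun u₁ _ u₂ _ h => padWord_injective hmn.le e h)]
  simp_rw [extendMap_apply_padWord]
  by_cases hw : IsPadWord hmn.le e w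
  · rw [extendMap_apply, dif_pos hw, wordRep_apply]
    refine Finset.sum_congr rfl fun u' _ => ?_
    congr 1
    rw [← e.prod_comp, Fintype.prod_sum_type]
    have h2 : ∏ j : Fin b, ((extendGL k (blockLetter_injective hmn.le) h : GL (Fin (n * n)) k) :
        Matrix (Fin (n * n)) (Fin (n * n)) k) (w (e (Sum.inr j)))
        (padWord hmn.le e u' (e (Sum.inr j))) = 1 := by
      refine Finset.prod_eq_one fun j _ => ?_
      rw [padWord_apply_inr, hw.2 j, coe_extendGL,
        extendMatrix_of_not_mem _ _ (padLetter_not_mem_range hmn), if_pos rfl]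
    rw [h2, mul_one]
    refine Finset.prod_congr rfl fun i _ => ?_
    rw [padWord_apply_inl, ← blockLetter_readWord hmn.le e w hw i, coe_extendGL, extendMatrix_app_app]
  · rw [extendMap_apply_of_not hmn.le e _ hw]
    refine Finset.sum_eq_zero fun u' _ => ?_
    unfold IsPadWord at hw
    rw [not_and_or, not_forall, not_forall] at hw
    rcases hw with ⟨i, hi⟩ | ⟨j, hj⟩
    · rw [Finset.prod_eq_zero (Finset.mem_univ (e (Sum.inl i))), zero_mul]
      rw [padWord_apply_inl, coe_extendGL, extendMatrix_of_not_mem_app _ _ hi]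
    · rw [Finset.prod_eq_zero (Finset.mem_univ (e (Sum.inr j))), zero_mul]
      rw [padWord_apply_inr, coe_extendGL]
      by_cases hj' : w (e (Sum.inr j)) ∈ Set.range (blockLetter hmn.le)
      · obtain ⟨x', hx'⟩ := hj'
        rw [← hx', extendMatrix_app_of_not_mem _ _ _ (padLetter_not_mem_range hmn)]
      · rw [extendMatrix_of_not_mem _ _ hj', if_neg hj]

/-- The weight of a diagonal element on a padded word: `∏_p d(padWord u p) =
(∏_i d(blockLetter (u i))) · d(ℓ)^b`. [cite: BurgisserEtAl2011, Prop. 5.6.2 (proof)] -/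
theorem prod_apply_padWord (hmn : m ≤ n) (e : Fin a ⊕ Fin b ≃ Fin D) (d : Fin (n * n) → k)
    (u : Word (m * m) a) :
    ∏ p, d (padWord hmn e u p) = (∏ i, d (blockLetter hmn (u i))) * d (padLetter n) ^ b := by
  rw [← e.prod_comp, Fintype.prod_sum_type]
  simp only [padWord_apply_inl, padWord_apply_inr, Finset.prod_const, Finset.card_univ,
    Fintype.card_fin]

variable [CharZero k]

/-- The balance weight of a padded word is `1` when `(n-m)·a = m·b`. [cite: BurgisserEtAl2011, Prop. 5.6.2 (proof)] -/
theorem prod_balanceDiag_padWord (hmn : m < n) (e : Fin a ⊕ Fin b ≃ Fin D) (hab : (n - m) * a = m * b)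
    (u : Word (m * m) a) : ∏ p, balanceDiag k hmn.le (padWord hmn.le e u p) = 1 := by
  classical
  rw [prod_apply_padWord]
  have h1 : ∀ i, balanceDiag k hmn.le (blockLetter hmn.le (u i)) = (2 : k) ^ (n - m) := fun i => by
    unfold balanceDiag; rw [if_pos ⟨u i, rfl⟩]
  have h2 : balanceDiag k hmn.le (padLetter n) = ((2 : k) ^ m)⁻¹ := by
    unfold balanceDiag
    rw [if_neg (padLetter_not_mem_range hmn), if_pos rfl]
  simp_rw [h1]
  rw [h2, Finset.prod_const, Finset.card_univ, Fintype.card_fin, ← pow_mul, inv_pow, ← pow_mul,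
    hab, mul_comm m b, mul_inv_cancel₀ (pow_ne_zero _ two_ne_zero)]

omit [CharZero k] in
/-- The kill weight of a padded word is `1`. [cite: BurgisserEtAl2011, Prop. 5.6.2 (proof)] -/
theorem prod_killDiag_padWord (hmn : m < n) (e : Fin a ⊕ Fin b ≃ Fin D) (u : Word (m * m) a) :
    ∏ p, killDiag k hmn.le (padWord hmn.le e u p) = 1 := by
  classical
  rw [prod_apply_padWord]
  have h1 : ∀ i, killDiag k hmn.le (blockLetter hmn.le (u i)) = 1 := fun i => by
    unfold killDiag; rw [if_pos (Or.inl ⟨u i, rfl⟩)]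
  have h2 : killDiag k hmn.le (padLetter n) = 1 := by
    unfold killDiag; rw [if_pos (Or.inr rfl)]
  simp_rw [h1]
  rw [h2, Finset.prod_const_one, one_pow, mul_one]

omit [CharZero k] in
/-- A pad word composed with `e (σ ⊔ ρ) e⁻¹`: `padWord u ∘ e(σ ⊔ ρ)e⁻¹ = padWord (u ∘ σ)`. [cite: BurgisserEtAl2011, Prop. 5.6.2 (proof)] -/
theorem padWord_comp_permCongr (hmn : m ≤ n) (e : Fin a ⊕ Fin b ≃ Fin D)
    (σ : Equiv.Perm (Fin a)) (ρ : Equiv.Perm (Fin b)) (u : Word (m * m) a) :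
    padWord hmn e u ∘ ⇑(e.permCongr (σ.sumCongr ρ)) = padWord hmn e (u ∘ ⇑σ) := by
  funext p
  obtain ⟨q, rfl⟩ := e.surjective p
  rw [Function.comp_apply, Equiv.permCongr_apply, Equiv.symm_apply_apply]
  rcases q with i | j
  · rw [Equiv.Perm.sumCongr_apply, Sum.map_inl, padWord_apply_inl, padWord_apply_inl,
      Function.comp_apply]
  · rw [Equiv.Perm.sumCongr_apply, Sum.map_inr, padWord_apply_inr, padWord_apply_inr]

omit [CharZero k] in
/-- **The position permutation `e (σ ⊔ ρ) e⁻¹` acts on restricted functions as `σ`**: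
`R_e (e(σ ⊔ ρ)e⁻¹ · y) = σ · R_e y`. [cite: BurgisserEtAl2011, Prop. 5.6.2 (proof)] -/
theorem restrictMap_wordPerm_permCongr (hmn : m ≤ n) (e : Fin a ⊕ Fin b ≃ Fin D)
    (σ : Equiv.Perm (Fin a)) (ρ : Equiv.Perm (Fin b)) (y : Word (n * n) D → k) :
    restrictMap k hmn e (wordPerm k (e.permCongr (σ.sumCongr ρ)) y) =
      wordPerm k σ (restrictMap k hmn e y) := by
  funext u
  rw [restrictMap_apply, wordPerm_apply, wordPerm_apply, restrictMap_apply, padWord_comp_permCongr]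

end Intertwine

/-! ### §5 Structure of the fixed space: support and the decomposition over the padding patterns -/

section StructureThm

variable {k : Type*} [Field k] [CharZero k] {m n a b D : ℕ} [NeZero n]

/-- **Restriction lands in the per-invariants**: for `y` fixed by the padded family, `R_e y` is fixed by
the per-family (`restrictMap_wordRep_extendGL`). BLMW: `(S_πW)^{GL(W)(x)} → (S_{π'}A)^{GL(A)(per_m)}`.
[cite: BurgisserEtAl2011, Prop. 5.6.2] -/
theorem restrictMap_mem_perStabInvariants (hmn : m < n) (e : Fin a ⊕ Fin b ≃ Fin D)
    {y : Word (n * n) D → k} (hy : y ∈ padInvariants k hmn D) :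
    restrictMap k hmn.le e y ∈ perStabInvariants k m a := by
  intro h hh
  rw [← restrictMap_wordRep_extendGL hmn e h y, hy _ (Or.inl ⟨h, hh, rfl⟩)]

/-- **Extension of per-invariants is fixed by the padded family** when the splitting is balanced,
`(n-m)·a = m·b` (`wordRep_extendGL_extendMap`, the balance and kill weights of a padded word are `1`).
[cite: BurgisserEtAl2011, Prop. 5.6.2] -/
theorem extendMap_mem_padInvariants (hmn : m < n) (e : Fin a ⊕ Fin b ≃ Fin D)
    (hab : (n - m) * a = m * b) {x : Word (m * m) a → k} (hx : x ∈ perStabInvariants k m a) :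
    extendMap k hmn.le e x ∈ padInvariants k hmn D := by
  classical
  intro g hg
  rcases hg with ⟨h, hh, rfl⟩ | rfl | rfl
  · rw [wordRep_extendGL_extendMap hmn, hx h hh]
  · funext w
    rw [wordRep_balanceGL_apply]
    by_cases hw : IsPadWord hmn.le e w
    · rw [← padWord_readWord hmn.le e w hw, prod_balanceDiag_padWord hmn e hab, one_mul]
    · rw [extendMap_apply_of_not hmn.le e _ hw, mul_zero]
  · funext w
    rw [wordRep_killGL_apply]
    by_cases hw : IsPadWord hmn.le e w
    · rw [← padWord_readWord hmn.le e w hw, prod_killDiag_padWord hmn e, one_mul]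
    · rw [extendMap_apply_of_not hmn.le e _ hw, mul_zero]

/-- In characteristic zero, `(2^s) · y = y` forces `s = 0` or `y = 0`; here: `2^s = 1 → s = 0`.
[folklore] -/
private theorem eq_zero_of_two_pow_eq_one {s : ℕ} (h : (2 : k) ^ s = 1) : s = 0 := by
  by_contra hs
  have h2 : (2 : k) ^ s = (2 : k) ^ 0 := by rw [h, pow_zero]
  exact hs (Nat.pow_right_injective (le_refl 2) (by exact_mod_cast h2))

/-- **Support of a fixed function (the kill element)**: `y(w) ≠ 0` forces every letter of `w` to be
a block letter or the padding letter. [cite: BurgisserEtAl2011, §5.6 (5.6.1)] -/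
theorem letters_of_mem_padInvariants (hmn : m < n) {y : Word (n * n) D → k}
    (hy : y ∈ padInvariants k hmn D) {w : Word (n * n) D} (hw : y w ≠ 0) (p : Fin D) :
    w p ∈ Set.range (blockLetter hmn.le) ∨ w p = padLetter n := by
  classical
  by_contra hp
  have h := congr_fun (hy _ (Or.inr (Or.inr rfl))) w
  rw [wordRep_killGL_apply] at h
  have h1 : ∏ q, killDiag k hmn.le (w q) = 1 := mul_right_cancel₀ hw (by rw [h, one_mul])
  -- the product is `2^{#letters of B}`
  have hprod : ∏ q, killDiag k hmn.le (w q) =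
      (2 : k) ^ (univ.filter fun q => ¬ (w q ∈ Set.range (blockLetter hmn.le) ∨ w q = padLetter n)).card := by
    unfold killDiag
    rw [Finset.prod_ite, Finset.prod_const_one, one_mul, Finset.prod_const]
  rw [hprod] at h1
  have hcard := eq_zero_of_two_pow_eq_one h1
  rw [Finset.card_eq_zero, Finset.filter_eq_empty_iff] at hcard
  exact hp (not_not.mp (hcard (Finset.mem_univ p)))

/-- `(2 : k)^x = 2^y` forces `x = y` in characteristic zero. [folklore] -/
private theorem two_pow_injective {x y : ℕ} (h : (2 : k) ^ x = (2 : k) ^ y) : x = y :=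
  Nat.pow_right_injective (le_refl 2) (by exact_mod_cast h)

/-- **Support of a fixed function (the balance element)**: if `y(w) ≠ 0` then
`(n-m) · #{block letters of w} = m · #{padding letters of w}` (`η^{n-m} ξ^m = 1` in (5.6.1) read on
the weight of `w`). [cite: BurgisserEtAl2011, §5.6 (5.6.1)] -/
theorem balance_of_mem_padInvariants (hmn : m < n) {y : Word (n * n) D → k}
    (hy : y ∈ padInvariants k hmn D) {w : Word (n * n) D} (hw : y w ≠ 0) :
    (n - m) * (univ.filter fun p => w p ∈ Set.range (blockLetter hmn.le)).card =
      m * (univ.filter fun p => w p = padLetter n).card := by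
  classical
  have h := congr_fun (hy _ (Or.inr (Or.inl rfl))) w
  rw [wordRep_balanceGL_apply] at h
  have h1 : ∏ q, balanceDiag k hmn.le (w q) = 1 := mul_right_cancel₀ hw (by rw [h, one_mul])
  have hprod : ∏ q, balanceDiag k hmn.le (w q) =
      ((2 : k) ^ (n - m)) ^ (univ.filter fun p => w p ∈ Set.range (blockLetter hmn.le)).card *
        (((2 : k) ^ m)⁻¹) ^ (univ.filter fun p => w p = padLetter n).card := by
    unfold balanceDiag
    rw [Finset.prod_ite, Finset.prod_const, Finset.prod_ite, Finset.prod_const, Finset.prod_const_one,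
      mul_one, Finset.filter_filter]
    congr 2
    refine congrArg Finset.card (Finset.filter_congr fun p _ => ?_)
    constructor
    · exact fun hp => hp.2
    · intro hp
      exact ⟨fun hmem => padLetter_not_mem_range hmn (hp ▸ hmem), hp⟩
  rw [hprod, ← pow_mul, inv_pow, ← pow_mul] at h1
  have h2 : (2 : k) ^ ((n - m) * (univ.filter fun p => w p ∈ Set.range (blockLetter hmn.le)).card) =
      (2 : k) ^ (m * (univ.filter fun p => w p = padLetter n).card) := by
    have hne : (2 : k) ^ (m * (univ.filter fun p => w p = padLetter n).card) ≠ 0 :=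
      pow_ne_zero _ two_ne_zero
    calc (2 : k) ^ ((n - m) * (univ.filter fun p => w p ∈ Set.range (blockLetter hmn.le)).card)
        = (2 : k) ^ ((n - m) * (univ.filter fun p => w p ∈ Set.range (blockLetter hmn.le)).card) *
            (((2 : k) ^ (m * (univ.filter fun p => w p = padLetter n).card))⁻¹ *
              (2 : k) ^ (m * (univ.filter fun p => w p = padLetter n).card)) := by
          rw [inv_mul_cancel₀ hne, mul_one]
      _ = (2 : k) ^ (m * (univ.filter fun p => w p = padLetter n).card) := by
          rw [← mul_assoc, h1, one_mul]
  exact two_pow_injective h2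

/-- **The padding count of a support word**: for a balanced splitting type (`a + b = D`,
`(n-m)·a = m·b`), a word in the support of a fixed function has exactly `b` padding letters.
[cite: BurgisserEtAl2011, §5.6 (5.6.1)] -/
theorem card_filter_eq_padLetter_of_mem_padInvariants (hmn : m < n) (hab : a + b = D)
    (hbal : (n - m) * a = m * b) {y : Word (n * n) D → k} (hy : y ∈ padInvariants k hmn D)
    {w : Word (n * n) D} (hw : y w ≠ 0) :
    (univ.filter fun p => w p = padLetter n).card = b := by
  classical
  set A := (univ.filter fun p => w p ∈ Set.range (blockLetter hmn.le)).card with hA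
  set P := (univ.filter fun p => w p = padLetter n).card with hP
  have hbalw : (n - m) * A = m * P := balance_of_mem_padInvariants hmn hy hw
  have hAP : A + P = D := by
    rw [hA, hP, ← Finset.card_union_of_disjoint]
    · have huniv : ((univ.filter fun p => w p ∈ Set.range (blockLetter hmn.le)) ∪
          univ.filter fun p => w p = padLetter n) = univ := by
        ext p
        simp only [Finset.mem_union, Finset.mem_filter, Finset.mem_univ, true_and, iff_true]
        exact letters_of_mem_padInvariants hmn hy hw p
      rw [huniv, Finset.card_univ, Fintype.card_fin]
    · rw [Finset.disjoint_filter]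
      intro p _ hp hpad
      exact padLetter_not_mem_range hmn (hpad ▸ hp)
  have key : ∀ A' P' : ℕ, (n - m) * A' = m * P' → n * P' = (n - m) * (A' + P') := fun A' P' h' => by
    have hnm : n - m + m = n := Nat.sub_add_cancel hmn.le
    calc n * P' = (n - m + m) * P' := by rw [hnm]
      _ = (n - m) * P' + m * P' := add_mul _ _ _
      _ = (n - m) * P' + (n - m) * A' := by rw [h']
      _ = (n - m) * (A' + P') := by ring
  have h1 := key A P hbalw
  have h2 := key a b hbal
  rw [hAP] at h1
  rw [hab] at h2
  exact Nat.eq_of_mul_eq_mul_left (NeZero.pos n) (h1.trans h2.symm)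

/-! #### Splittings attached to padding patterns -/

/-- The splitting `[a] ⊔ [b] ≃ [D]` attached to a `b`-subset `S ⊂ [D]` (`a + b = D`): `inr` onto `S`,
`inl` onto the complement. [cite: BurgisserEtAl2011, Prop. 5.6.2 (proof)] -/
def splitEquiv (hab : a + b = D) (S : Finset (Fin D)) (hS : S.card = b) : Fin a ⊕ Fin b ≃ Fin D :=
  have hSc : Sᶜ.card = a := by rw [Finset.card_compl, Fintype.card_fin]; omega
  (Equiv.sumComm (Fin a) (Fin b)).trans
    ((Equiv.sumCongr (S.equivFinOfCardEq hS).symm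
      ((Sᶜ.equivFinOfCardEq hSc).symm.trans
        (Equiv.subtypeEquivRight (fun p => Finset.mem_compl)))).trans
      (Equiv.sumCompl (fun p => p ∈ S)))

/-- `splitEquiv S (inr j) ∈ S`. [cite: BurgisserEtAl2011, Prop. 5.6.2 (proof)] -/
theorem splitEquiv_inr_mem (hab : a + b = D) (S : Finset (Fin D)) (hS : S.card = b) (j : Fin b) :
    splitEquiv hab S hS (Sum.inr j) ∈ S := by
  unfold splitEquiv
  simp only [Equiv.trans_apply, Equiv.sumComm_apply, Sum.swap_inr, Equiv.sumCongr_apply, Sum.map_inl,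
    Equiv.sumCompl_apply_inl]
  exact Subtype.prop _

/-- `splitEquiv S (inl i) ∉ S`. [cite: BurgisserEtAl2011, Prop. 5.6.2 (proof)] -/
theorem splitEquiv_inl_not_mem (hab : a + b = D) (S : Finset (Fin D)) (hS : S.card = b) (i : Fin a) :
    splitEquiv hab S hS (Sum.inl i) ∉ S := by
  unfold splitEquiv
  simp only [Equiv.trans_apply, Equiv.sumComm_apply, Sum.swap_inl, Equiv.sumCongr_apply, Sum.map_inr,
    Equiv.sumCompl_apply_inr, Equiv.subtypeEquivRight_apply_coe]
  exact Finset.mem_compl.mp (Subtype.prop _)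

/-- A position off `S` is `splitEquiv S (inl i)` for some `i`. [cite: BurgisserEtAl2011, Prop. 5.6.2 (proof)] -/
theorem exists_splitEquiv_inl_eq (hab : a + b = D) (S : Finset (Fin D)) (hS : S.card = b) {p : Fin D}
    (hp : p ∉ S) : ∃ i, splitEquiv hab S hS (Sum.inl i) = p := by
  obtain ⟨q, hq⟩ := (splitEquiv hab S hS).surjective p
  rcases q with i | j
  · exact ⟨i, hq⟩
  · exact absurd (hq ▸ splitEquiv_inr_mem hab S hS j) hp

/-- A position in `S` is `splitEquiv S (inr j)` for some `j`. [cite: BurgisserEtAl2011, Prop. 5.6.2 (proof)] -/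
theorem exists_splitEquiv_inr_eq (hab : a + b = D) (S : Finset (Fin D)) (hS : S.card = b) {p : Fin D}
    (hp : p ∈ S) : ∃ j, splitEquiv hab S hS (Sum.inr j) = p := by
  obtain ⟨q, hq⟩ := (splitEquiv hab S hS).surjective p
  rcases q with i | j
  · exact absurd hp (hq ▸ splitEquiv_inl_not_mem hab S hS i)
  · exact ⟨j, hq⟩

/-- **Pad words of the splitting of `S`**: padding letters exactly on `S`, block letters elsewhere.
[cite: BurgisserEtAl2011, Prop. 5.6.2 (proof)] -/
theorem isPadWord_splitEquiv_iff (hmn : m < n) (hab : a + b = D) (S : Finset (Fin D)) (hS : S.card = b)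
    (w : Word (n * n) D) :
    IsPadWord hmn.le (splitEquiv hab S hS) w ↔
      (∀ p ∈ S, w p = padLetter n) ∧ ∀ p ∉ S, w p ∈ Set.range (blockLetter hmn.le) := by
  constructor
  · rintro ⟨h1, h2⟩
    refine ⟨fun p hp => ?_, fun p hp => ?_⟩
    · obtain ⟨j, rfl⟩ := exists_splitEquiv_inr_eq hab S hS hp
      exact h2 j
    · obtain ⟨i, rfl⟩ := exists_splitEquiv_inl_eq hab S hS hp
      exact h1 i
  · rintro ⟨h1, h2⟩
    exact ⟨fun i => h2 _ (splitEquiv_inl_not_mem hab S hS i),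
      fun j => h1 _ (splitEquiv_inr_mem hab S hS j)⟩

/-- For a word whose letters are block letters or the padding letter, the pad words of `S` are
those whose padding pattern IS `S`. [cite: BurgisserEtAl2011, Prop. 5.6.2 (proof)] -/
theorem isPadWord_splitEquiv_iff_eq (hmn : m < n) (hab : a + b = D) (S : Finset (Fin D))
    (hS : S.card = b) {w : Word (n * n) D}
    (hw : ∀ p, w p ∈ Set.range (blockLetter hmn.le) ∨ w p = padLetter n) :
    IsPadWord hmn.le (splitEquiv hab S hS) w ↔ S = univ.filter fun p => w p = padLetter n := by
  classical
  rw [isPadWord_splitEquiv_iff hmn]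
  constructor
  · rintro ⟨h1, h2⟩
    ext p
    simp only [Finset.mem_filter, Finset.mem_univ, true_and]
    constructor
    · exact h1 p
    · intro hp
      by_contra hpS
      exact padLetter_not_mem_range hmn (hp ▸ h2 p hpS)
  · intro hS'
    subst hS'
    refine ⟨fun p hp => (Finset.mem_filter.mp hp).2, fun p hp => ?_⟩
    rcases hw p with h | h
    · exact h
    · exact (hp (Finset.mem_filter.mpr ⟨Finset.mem_univ p, h⟩)).elim

/-- **The decomposition over the padding patterns**: for a balanced splitting type, every function
fixed by the padded family is the sum of its pattern components,
`y = ∑_{|S| = b} E_S (R_S y)` — BLMW: `(S_πW)^{GL(W)(x)} ⊆ ⊕_{π ↦ π'} …` at the level of `W^{⊗D}`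
(Pieri's direct sum over the placements of `A'`). [cite: BurgisserEtAl2011, Prop. 5.6.2] -/
theorem sum_extendMap_restrictMap (hmn : m < n) (hab : a + b = D) (hbal : (n - m) * a = m * b)
    {y : Word (n * n) D → k} (hy : y ∈ padInvariants k hmn D) :
    ∑ S : {S : Finset (Fin D) // S.card = b},
        extendMap k hmn.le (splitEquiv hab S.1 S.2) (restrictMap k hmn.le (splitEquiv hab S.1 S.2) y) = y := by
  classical
  funext w
  rw [Finset.sum_apply]
  simp_rw [extendMap_restrictMap_apply]
  by_cases hw : y w = 0
  · rw [hw]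
    exact Finset.sum_eq_zero fun S _ => ite_self 0
  · have hletters := letters_of_mem_padInvariants hmn hy hw
    have hcount := card_filter_eq_padLetter_of_mem_padInvariants hmn hab hbal hy hw
    set S₀ : {S : Finset (Fin D) // S.card = b} := ⟨univ.filter fun p => w p = padLetter n, hcount⟩ with hS₀
    rw [Finset.sum_ite, Finset.sum_const_zero, add_zero, Finset.sum_const]
    have hfilter : (univ.filter fun S : {S : Finset (Fin D) // S.card = b} =>
        IsPadWord hmn.le (splitEquiv hab S.1 S.2) w) = {S₀} := by
      ext S
      simp only [Finset.mem_filter, Finset.mem_univ, true_and, Finset.mem_singleton]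
      rw [isPadWord_splitEquiv_iff_eq hmn hab S.1 S.2 hletters]
      constructor
      · intro h
        exact Subtype.ext h
      · intro h
        rw [h]
    rw [hfilter, Finset.card_singleton, one_smul]

end StructureThm

/-! ### §6 The character of the fixed space -/

section Character

variable {k : Type*} [Field k] [CharZero k] {m n a b D : ℕ} [NeZero n]

/-- Restriction as a map from the fixed space to the per-invariants. [cite: BurgisserEtAl2011, Prop. 5.6.2 (proof)] -/
def restrictInv (hmn : m < n) (e : Fin a ⊕ Fin b ≃ Fin D) :
    padInvariants k hmn D →ₗ[k] perStabInvariants k m a :=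
  LinearMap.codRestrict _ ((restrictMap k hmn.le e).comp (padInvariants k hmn D).subtype)
    (fun y => restrictMap_mem_perStabInvariants hmn e y.2)

/-- Extension as a map from the per-invariants to the fixed space (balanced splitting type).
[cite: BurgisserEtAl2011, Prop. 5.6.2 (proof)] -/
def extendInv (hmn : m < n) (e : Fin a ⊕ Fin b ≃ Fin D) (hbal : (n - m) * a = m * b) :
    perStabInvariants k m a →ₗ[k] padInvariants k hmn D :=
  LinearMap.codRestrict _ ((extendMap k hmn.le e).comp (perStabInvariants k m a).subtype)
    (fun x => extendMap_mem_padInvariants hmn e hbal x.2)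

/-- Coercion of `restrictInv`. [cite: BurgisserEtAl2011, Prop. 5.6.2 (proof)] -/
@[simp]
theorem coe_restrictInv (hmn : m < n) (e : Fin a ⊕ Fin b ≃ Fin D) (y : padInvariants k hmn D) :
    (restrictInv hmn e y : Word (m * m) a → k) = restrictMap k hmn.le e y :=
  rfl

/-- Coercion of `extendInv`. [cite: BurgisserEtAl2011, Prop. 5.6.2 (proof)] -/
@[simp]
theorem coe_extendInv (hmn : m < n) (e : Fin a ⊕ Fin b ≃ Fin D) (hbal : (n - m) * a = m * b)
    (x : perStabInvariants k m a) :
    (extendInv hmn e hbal x : Word (n * n) D → k) = extendMap k hmn.le e x :=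
  rfl

/-- `∑_S E_S ∘ R_S = id` on the fixed space. [cite: BurgisserEtAl2011, Prop. 5.6.2 (proof)] -/
theorem sum_extendInv_comp_restrictInv (hmn : m < n) (hab : a + b = D) (hbal : (n - m) * a = m * b) :
    ∑ S : {S : Finset (Fin D) // S.card = b},
        (extendInv hmn (splitEquiv hab S.1 S.2) hbal).comp (restrictInv (k := k) hmn (splitEquiv hab S.1 S.2)) =
      LinearMap.id := by
  apply LinearMap.ext
  intro y
  apply Subtype.ext
  rw [LinearMap.sum_apply, Submodule.coe_sum, LinearMap.id_apply]
  simp only [LinearMap.comp_apply, coe_extendInv, coe_restrictInv]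
  exact sum_extendMap_restrictMap hmn hab hbal y.2

/-- **`R_e ∘ τ ∘ E_e = σ` for `τ = e (σ ⊔ ρ) e⁻¹`** on the per-invariants. [cite: BurgisserEtAl2011, Prop. 5.6.2 (proof)] -/
theorem restrictInv_comp_perm_comp_extendInv (hmn : m < n) (e : Fin a ⊕ Fin b ≃ Fin D)
    (hbal : (n - m) * a = m * b) (σ : Equiv.Perm (Fin a)) (ρ : Equiv.Perm (Fin b)) :
    (restrictInv hmn e).comp
        (((wordPermRep k (n * n) D).subrepresentation (padInvariants k hmn D)
            (padInvariants_le_comap k hmn) (e.permCongr (σ.sumCongr ρ))).comp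
          (extendInv (k := k) hmn e hbal)) =
      perStabInvariantsPermRep k m (D := a) σ := by
  apply LinearMap.ext
  intro x
  apply Subtype.ext
  change restrictMap k hmn.le e (wordPerm k (e.permCongr (σ.sumCongr ρ)) (extendMap k hmn.le e x)) =
    wordPerm k σ (x : Word (m * m) a → k)
  rw [restrictMap_wordPerm_permCongr, restrictMap_extendMap]

/-- **`R_e ∘ τ ∘ E_e = 0` when `τ` moves a padding position of `e` off the padding positions.**
[cite: BurgisserEtAl2011, Prop. 5.6.2 (proof)] -/
theorem restrictInv_comp_perm_comp_extendInv_eq_zero (hmn : m < n) (e : Fin a ⊕ Fin b ≃ Fin D)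
    (hbal : (n - m) * a = m * b) (τ : Equiv.Perm (Fin D))
    (hτ : ¬ ∀ j, ∃ j', τ (e (Sum.inr j)) = e (Sum.inr j')) :
    (restrictInv hmn e).comp
        (((wordPermRep k (n * n) D).subrepresentation (padInvariants k hmn D)
            (padInvariants_le_comap k hmn) τ).comp
          (extendInv (k := k) hmn e hbal)) = 0 := by
  apply LinearMap.ext
  intro x
  apply Subtype.ext
  change restrictMap k hmn.le e (wordPerm k τ (extendMap k hmn.le e x)) = 0
  funext u
  rw [restrictMap_apply, wordPerm_apply, Pi.zero_apply, extendMap_apply_of_not]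
  intro hpw
  apply hτ
  intro j
  have hj := hpw.2 j
  rw [Function.comp_apply] at hj
  -- `padWord u p = ℓ` forces `p` to be a padding position
  obtain ⟨q, hq⟩ := e.surjective (τ (e (Sum.inr j)))
  rcases q with i | j'
  · rw [← hq, padWord_apply_inl] at hj
    exact absurd hj.symm (padLetter_ne_blockLetter hmn _)
  · exact ⟨j', hq.symm⟩

/-- **Summation over `𝔖_D` of a function supported on the stabilizer of the padding positions of
`e`**: `∑_τ g(τ) = ∑_{σ, ρ} g(e (σ ⊔ ρ) e⁻¹)` (the stabilizer of `e(inr [b])` in `𝔖_D` is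
`e (𝔖_a × 𝔖_b) e⁻¹`, Mathlib `Equiv.Perm.mem_sumCongrHom_range_of_perm_mapsTo_inl`). [cite: BurgisserEtAl2011, Prop. 5.6.2 (proof)] -/
theorem sum_eq_sum_sum_permCongr {M : Type*} [AddCommMonoid M] (e : Fin a ⊕ Fin b ≃ Fin D)
    (g : Equiv.Perm (Fin D) → M) (hg : ∀ τ, (¬ ∀ j, ∃ j', τ (e (Sum.inr j)) = e (Sum.inr j')) → g τ = 0) :
    ∑ τ, g τ = ∑ σ : Equiv.Perm (Fin a), ∑ ρ : Equiv.Perm (Fin b), g (e.permCongr (σ.sumCongr ρ)) := by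
  classical
  set φ : Equiv.Perm (Fin a) × Equiv.Perm (Fin b) → Equiv.Perm (Fin D) :=
    fun p => e.permCongr (p.1.sumCongr p.2) with hφ
  have hinj : Function.Injective φ := by
    intro p q hpq
    have h := (Equiv.permCongr e).injective hpq
    have h1 : p.1 = q.1 := Equiv.ext fun i => by
      have := congr_fun (congrArg (⇑) h) (Sum.inl i)
      simpa [Equiv.Perm.sumCongr_apply] using this
    have h2 : p.2 = q.2 := Equiv.ext fun j => by
      have := congr_fun (congrArg (⇑) h) (Sum.inr j)
      simpa [Equiv.Perm.sumCongr_apply] using this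
    exact Prod.ext h1 h2
  rw [← Finset.sum_product', Finset.univ_product_univ,
    ← Finset.sum_image (f := g) (s := (univ : Finset (Equiv.Perm (Fin a) × Equiv.Perm (Fin b))))
      (fun p _ q _ h => hinj h)]
  symm
  refine Finset.sum_subset (Finset.subset_univ _) fun τ _ hτ => hg τ fun hpres => hτ ?_
  -- `τ` preserves the padding positions, hence is a block permutation
  set τ₀ : Equiv.Perm (Fin a ⊕ Fin b) := (Equiv.permCongr e).symm τ with hτ₀
  have hτ₀inr : ∀ j, ∃ j', τ₀ (Sum.inr j) = Sum.inr j' := by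
    intro j
    obtain ⟨j', hj'⟩ := hpres j
    refine ⟨j', ?_⟩
    rw [hτ₀, Equiv.permCongr_symm, Equiv.permCongr_apply, Equiv.symm_symm, hj', Equiv.symm_apply_apply]
  -- the induced self-map of `Fin b` is injective, hence surjective
  choose ψ hψ using hτ₀inr
  have hψinj : Function.Injective ψ := by
    intro j₁ j₂ h
    have : τ₀ (Sum.inr j₁) = τ₀ (Sum.inr j₂) := by rw [hψ, hψ, h]
    exact Sum.inr_injective (τ₀.injective this)
  have hψsurj : Function.Surjective ψ := Finite.surjective_of_injective hψinj
  have hmaps : Set.MapsTo τ₀ (Set.range Sum.inl) (Set.range Sum.inl) := by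
    rintro _ ⟨i, rfl⟩
    rcases hx : τ₀ (Sum.inl i) with i' | j
    · exact ⟨i', rfl⟩
    · exfalso
      obtain ⟨j', hj'⟩ := hψsurj j
      have : τ₀ (Sum.inl i) = τ₀ (Sum.inr j') := by rw [hx, hψ, hj']
      exact Sum.inl_ne_inr (τ₀.injective this)
  obtain ⟨⟨σ, ρ⟩, hσρ⟩ := MonoidHom.mem_range.mp (Equiv.Perm.mem_sumCongrHom_range_of_perm_mapsTo_inl hmaps)
  rw [Equiv.Perm.sumCongrHom_apply] at hσρ
  refine Finset.mem_image.mpr ⟨(σ, ρ), Finset.mem_univ _, ?_⟩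
  rw [hφ]
  dsimp only
  rw [hσρ, hτ₀, Equiv.apply_symm_apply]

/-- **The character of the fixed space of the padded family** (balanced splitting type `a + b = D`,
`(n-m)·a = m·b`): for every `f : 𝔖_D → k`,
`∑_τ f(τ) χ_{padInvariants}(τ) = ∑_{|S| = b} ∑_{σ ∈ 𝔖_a} ∑_{ρ ∈ 𝔖_b} f(e_S (σ ⊔ ρ) e_S⁻¹) · χ_{X_per(a)}(σ)`
— the fixed space is `⊕_S E_S(X_per(a))` with `τ` permuting the summands, so `tr τ = ∑_{τS = S}
tr(τ | E_S X_per) = ∑_{τ = e_S(σ⊔ρ)e_S⁻¹} χ_{X_per}(σ)` (the character of `Ind_{𝔖_a × 𝔖_b}(X_per ⊠ 1)`,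
Fulton–Harris §3.3). With `f = χ^π` this is the `𝔖_D`-side of BLMW's
`dim (S_πW)^{GL(W)(x)} = ∑_{π ↦ π'} dim (S_{π'}A)^{GL(A)(per_m)}`. [cite: BurgisserEtAl2011, Prop. 5.6.2] -/
theorem sum_mul_character_padInvariants (hmn : m < n) (hab : a + b = D) (hbal : (n - m) * a = m * b)
    (f : Equiv.Perm (Fin D) → k) :
    ∑ τ : Equiv.Perm (Fin D), f τ *
        ((wordPermRep k (n * n) D).subrepresentation (padInvariants k hmn D)
          (padInvariants_le_comap k hmn)).character τ =
      ∑ S : {S : Finset (Fin D) // S.card = b}, ∑ σ : Equiv.Perm (Fin a), ∑ ρ : Equiv.Perm (Fin b),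
        f ((splitEquiv hab S.1 S.2).permCongr (σ.sumCongr ρ)) *
          (perStabInvariantsPermRep k m (D := a)).character σ := by
  classical
  set ρX := (wordPermRep k (n * n) D).subrepresentation (padInvariants k hmn D)
    (padInvariants_le_comap k hmn) with hρX
  -- `tr τ = ∑_S tr(τ ∘ E_S ∘ R_S) = ∑_S tr(R_S ∘ τ ∘ E_S)`
  have htrace : ∀ τ, ρX.character τ = ∑ S : {S : Finset (Fin D) // S.card = b},
      LinearMap.trace k _ ((restrictInv hmn (splitEquiv hab S.1 S.2)).comp
        ((ρX τ).comp (extendInv (k := k) hmn (splitEquiv hab S.1 S.2) hbal))) := by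
    intro τ
    rw [Representation.character]
    have hcomp : ρX τ = ∑ S : {S : Finset (Fin D) // S.card = b},
        (ρX τ).comp ((extendInv hmn (splitEquiv hab S.1 S.2) hbal).comp
          (restrictInv (k := k) hmn (splitEquiv hab S.1 S.2))) := by
      conv_lhs => rw [← LinearMap.comp_id (ρX τ), ← sum_extendInv_comp_restrictInv hmn hab hbal]
      apply LinearMap.ext
      intro y
      simp only [LinearMap.comp_apply, LinearMap.sum_apply, map_sum]
    conv_lhs => rw [hcomp, map_sum]
    refine Finset.sum_congr rfl fun S _ => ?_
    rw [← LinearMap.comp_assoc, LinearMap.trace_comp_comm']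
  simp_rw [htrace, Finset.mul_sum]
  rw [Finset.sum_comm]
  refine Finset.sum_congr rfl fun S _ => ?_
  rw [sum_eq_sum_sum_permCongr (splitEquiv hab S.1 S.2)]
  · refine Finset.sum_congr rfl fun σ _ => Finset.sum_congr rfl fun ρ _ => ?_
    rw [hρX, restrictInv_comp_perm_comp_extendInv hmn _ hbal, Representation.character]
  · intro τ hτ
    rw [hρX, restrictInv_comp_perm_comp_extendInv_eq_zero hmn _ hbal τ hτ, map_zero, mul_zero]

/-- The number of padding patterns is `C(D, b)`. [cite: BurgisserEtAl2011, Prop. 5.6.2 (proof)] -/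
theorem card_patterns (D b : ℕ) :
    Fintype.card {S : Finset (Fin D) // S.card = b} = D.choose b := by
  rw [Fintype.card_subtype, ← Finset.powerset_univ, ← Finset.powersetCard_eq_filter,
    Finset.card_powersetCard, Finset.card_univ, Fintype.card_fin]

end Character


end PadPer

end Literature.Computability.AlgebraicComplexity

end
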